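import Literature.Analysis.FluidPDE.TypeIAncientMildClassical
import Literature.Analysis.FluidPDE.AxisymmetricVorticityTransport
import HarnessLib

/-!
# Stub `stub_swirlEquation` of the line `absorbing-axis-swirl-extinction`
# (crux `AxisymEndLiouville`, stmt-NavierStokesRegularity-14061, route `SymmetryModuliCount`)

The swirl equation in the Type I ancient mild class `𝒜_C` (`IsTypeIAncientMild C u`).  On every
window `(t₀, 0)`, `t₀ < 0`, an element `u` of the class is a classical solution of the unforced
Navier–Stokes system with unit viscosity for some smooth pressure `p`
(`IsTypeIAncientMild.exists_isClassicalNSSolutionOn_Ioo`: mild + smooth + bounded ⇒ classical,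
Fabes–Jones–Rivière 1972).  If the velocity slices `u t` are axisymmetric for all `t < 0`, the
pressure slices are axisymmetric scalars (`IsClassicalNSSolutionOn.isAxisymmetricScalar_pressure`,
the open window `Ioo t₀ 0` being a set of unique differentiability, the zero force being
axisymmetric), and hence the swirl `Γ = r u_θ = x₀u₁ − x₁u₀` satisfies, off the axis `{r = 0}`,
the drift–diffusion equation of Koch–Nadirashvili–Seregin–Šverák 2009, eq. (1.8),
`∂ₜΓ + (u·∇)Γ = ΔΓ − (2/r)∂ᵣΓ`
(the tree's discharged named fact `swirl_transport_holds`, specialised to `ν = 1`, `f = 0`).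
This is the composition used in `Literature.Analysis.FluidPDE.SwirlMaximumPrinciple`
(`sign_mul_swirl_le_of_classical`), here on the open windows of the ancient class.
-/

noncomputable section

-- the summit and its single problem share the name (D-0017 nested layout)
set_option linter.dupNamespace false

open Set Function Filter Topology MeasureTheory InnerProductSpace Metric
open scoped RealInnerProductSpace Laplacian ContDiff NNReal

namespace Summit.NavierStokesRegularity.NavierStokesRegularity.Theorems.AxisymEndLiouville.AbsorbingAxisSwirlExtinction

open Literature.Analysis.FluidPDE

/-- Local notation for physical space `ℝ³`. -/
local notation "E3" => EuclideanSpace ℝ (Fin 3)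

/-- **STUB 4 (the swirl equation in the class).**  On every window `(t₀, 0)`, `t₀ < 0`, an
element `u` of the Type I ancient mild class `𝒜_C` whose slices are axisymmetric for all `t < 0`
is a classical Navier–Stokes solution (unit viscosity, zero force) for some pressure `p`, and its
swirl `Γ = swirl (u t)` satisfies KNSS 2009 (1.8), `∂ₜΓ + u·∇Γ = ΔΓ − (2/r)∂ᵣΓ`, at every point
off the axis (`cylRadius x ≠ 0`), the time derivative being the one within the window. Proof:
`exists_isClassicalNSSolutionOn_Ioo` gives the pressure, `isAxisymmetricScalar_pressure` its
axisymmetry (`uniqueDiffOn_Ioo`, the zero force is axisymmetric), and `swirl_transport_holds`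
with `ν = 1`, `f = 0` (`swirl 0 = 0`) the equation. -/
theorem stub_swirlEquation (C : ℝ) (u : ℝ → E3 → E3) (hu : IsTypeIAncientMild C u)
    (haxi : ∀ t < 0, IsAxisymmetric (u t)) (t₀ : ℝ) (ht₀ : t₀ < 0) :
    ∃ p : ℝ → E3 → ℝ, IsClassicalNSSolutionOn (Ioo t₀ 0) 1 0 u p ∧
      ∀ t ∈ Ioo t₀ 0, ∀ x, cylRadius x ≠ 0 →
        timeDerivWithin (Ioo t₀ 0) (fun s => swirl (u s)) t x + convect (u t) (swirl (u t)) x =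
          (Δ (swirl (u t))) x - 2 / cylRadius x * partialDeriv (eR x) (swirl (u t)) x := by
  -- the classical pressure on the window
  obtain ⟨p, hcl⟩ := hu.exists_isClassicalNSSolutionOn_Ioo ht₀
  have haxiS : ∀ t ∈ Ioo t₀ 0, IsAxisymmetric (u t) := fun t ht => haxi t ht.2
  -- the zero force is axisymmetric, hence so is the pressure
  have hf : ∀ t ∈ Ioo t₀ 0, IsAxisymmetric ((0 : ℝ → E3 → E3) t) := fun _ _ θ y => by
    ext i
    fin_cases i <;> simp
  have hp : ∀ t ∈ Ioo t₀ 0, IsAxisymmetricScalar (p t) := fun t ht =>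
    hcl.isAxisymmetricScalar_pressure (uniqueDiffOn_Ioo t₀ 0) haxiS hf ht
  refine ⟨p, hcl, fun t ht x hx => ?_⟩
  -- KNSS (1.8) with `ν = 1`, `f = 0`
  have hpde := swirl_transport_holds hcl haxiS hp ht hx
  have hf0 : swirl ((0 : ℝ → E3 → E3) t) x = 0 := by simp [swirl]
  rw [hf0, add_zero, one_mul] at hpde
  exact hpde

end Summit.NavierStokesRegularity.NavierStokesRegularity.Theorems.AxisymEndLiouville.AbsorbingAxisSwirlExtinction
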